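import Summits.HubbardSuperconductivity.HubbardSuperconductivity.Theses.ThermalWedge
import Summits.HubbardSuperconductivity.HubbardSuperconductivity.Theorems.ThermalWedgeTwPureThermalBoundGsee

/-!
# Route `ThermalWedge`: `TwPureThermalBound` holds (item stmt-HubbardSuperconductivity-1702)

Closing file: the route decl `Summit.HubbardSuperconductivity.HubbardSuperconductivity.Theses.ThermalWedge.TwPureThermalBound`
is its verbatim body `TwPureThermalBoundGsee.twPureThermalBound_body` (thermodynamic limit and
convexity of the canonical ground-state energy density of the 2D Hubbard torus, a subgradient
chemical potential in the free-gas window, and the `β`-collapse `Z ≤ 4^{L²}e^{-βE₀}`).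
-/

set_option linter.dupNamespace false

namespace Summit.HubbardSuperconductivity.HubbardSuperconductivity.Theorems

/-- **`TwPureThermalBound` holds** (route `HubbardSuperconductivity/ThermalWedge`, support item
stmt-HubbardSuperconductivity-1702): canonical `(N_L, S^z = 0)` ground energy per site of the pure
repulsive Hubbard torus plus the grand-canonical pressure at a `δ`-uniform chemical potential minus
`μ N_L/L²` is at most `log 4/β + ε`, eventually in `L`. [cite: Ruelle1969, §3.4] -/
theorem twPureThermalBound_proof :
    Summit.HubbardSuperconductivity.HubbardSuperconductivity.Theses.ThermalWedge.TwPureThermalBound :=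
  TwPureThermalBoundGsee.twPureThermalBound_body

end Summit.HubbardSuperconductivity.HubbardSuperconductivity.Theorems
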